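import Summits.Langlands.Langlands.Theorems.DedekindQuotient1951PartialLEntireLevel
import Summits.Langlands.Langlands.Theorems.DedekindQuotient1951PartialLEntireUnfoldingData
import Summits.Langlands.Langlands.Theorems.DedekindQuotient1951PartialLEntirePatching
import Literature.NumberTheory.Automorphic.GodementJacquetZetaIntegralsProofs
import Literature.NumberTheory.Automorphic.SatakeParameterBoundHolds

/-!
# Route `DedekindQuotient1951` (Langlands) — support `PartialLEntire` (stmt-Langlands-17273):
# Godement–Jacquet, Thm. 13.8 (entire case) for honest partial standard L-functions in `L²_cusp`

For a cuspidal `Π ⊂ L²_cusp(GL_n(K) A_G \ GL_n(𝔸_K))`, `n ≥ 2`, a finite set `S` of finite places and an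
honest Satake family `α` of `Π` off `S` (`IsSatakeFamilyOf`, so `S` contains the ramified places),
the partial standard L-function `L^S(s, Π)` (`partialStandardL`) has entire continuation
(`hasEntireContinuation_partialStandardL_of_two_le`). The tree holds the meromorphic continuation
(`partialStandardL_hasMeromorphicContinuation_holds`); the entire refinement is obtained from the same
bricks:

1. a non-zero `K`-finite `φ ∈ Π` of an `S`-GOOD level `K(𝔫₀)` (`exists_isKFiniteVector_sGoodLevel`,
   so that the unfolding set of places is `T = S`: no unramified Euler polynomial is moved into the
   local factor);
2. for a prescribed `s₀`, the unfolding data `𝔫, Φ_∞, N` at the level of `φ` with the archimedean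
   bump supported where `|im s₀ · log |det a|_𝔸| < 1` (`exists_unfolding_data_of_level`), the test
   function `Φ = Φ_∞ ⊗ 1_{B(𝔫)}`, and the `K^T`-spherical unfolding `Z(Φ, s', φ, φ) =
   c · vol(K^T) · L^T(s) · Z_T(s')`, `s' = s + (n-1)/2` (`gjZeta_awayProductMeasure_eq`), i.e.
   `Z = A · L^S` far to the right with `A(s) = c · vol(K^T) · Z_T(s')` entire
   (`differentiable_placesZeta`) and `A(s₀) ≠ 0` (`re_placesZeta_pos_of_im_eq`);
3. `Z` is entire for `n ≥ 2` (`GodementJacquet1972_gjZeta_meromorphic_holds`: Poisson summation and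
   the vanishing of the singular defect on cusp forms);
4. `L^S` is holomorphic on `re s > 1` (Jacquet–Shalika, `differentiableOn_partialStandardL_of_summable`
   with `summable_normSq_trace_satakePow_holds`), and the complex-analytic patching
   `hasEntireContinuation_of_quotients`.

References: R. Godement, H. Jacquet, *Zeta functions of simple algebras*, LNM 260 (1972), Thm. 13.8
with Thm. 3.3, Lemma 6.10, §§11–13; H. Jacquet, *Principal L-functions of the linear group*, Proc.
Symp. Pure Math. 33.2 (1979), Thm. (6.2); H. Jacquet, J. Shalika, Amer. J. Math. 103 (1981), Thm. (5.3).
-/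

set_option linter.dupNamespace false

noncomputable section

open scoped MatrixGroups NNReal Topology Classical InnerProductSpace ENNReal
open NumberField NumberField.mixedEmbedding IsDedekindDomain MeasureTheory Filter Polynomial
open Literature.NumberTheory.Automorphic

namespace Summit.Langlands.Langlands.Theorems.DedekindQuotient1951

variable {n : ℕ} {K : Type} [Field K] [NumberField K]
  {μ : Measure (AdelicGroupData.gl n K).automorphicQuotient} [(AdelicGroupData.gl n K).IsAutomorphicMeasure μ]

/-- The shift `s ↦ s + (n-1)/2` does not change imaginary parts. [folklore] -/
theorem im_add_half_sub_one (s : ℂ) : (s + ((n : ℂ) - 1) / 2).im = s.im := by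
  have e : ((n : ℂ) - 1) / 2 = ((((n : ℝ) - 1) / 2 : ℝ) : ℂ) := by push_cast; ring
  rw [e, Complex.add_im, Complex.ofReal_im, add_zero]

/-- **The zeta-quotient representation of `L^S(s, Π)` with a local factor non-vanishing at a
prescribed point.** For cuspidal `Π`, finite `S`, an honest Satake family `α` of `Π` off `S`, a Haar
measure `ν` on `GL_n(𝔸_K)` and any `s₀ ∈ ℂ`, there are `Φ ∈ 𝒮(M_n(𝔸_K))`, a non-zero `K`-finite
`φ ∈ Π` and an ENTIRE `A` with `A(s₀) ≠ 0` such that `Z(Φ, s + (n-1)/2, φ, φ) = A(s) · L^S(s, Π)` for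
`re s > n² + n + 3`: the `K^T`-spherical unfolding of `GodementJacquet1972_gjZeta_eulerFactorisation_holds`
run at an `S`-good level of `φ` (`exists_isKFiniteVector_sGoodLevel`), so that `T = S` and
`A = c · vol(K^T) · Z_T(s + (n-1)/2)` (no Euler polynomial enters `A`), with the archimedean bump
shrunk so that `Re Z_T > 0` on the horizontal line through `s₀ + (n-1)/2`
(`exists_unfolding_data_of_level`, `re_placesZeta_pos_of_im_eq`). Godement–Jacquet (1972), proof of
Thm. 13.8 with Lemma 6.10. [cite: GodementJacquet1972, Thm. 13.8 (proof) with Lemma 6.10] -/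
theorem exists_gjZeta_eq_mul_partialStandardL_ne_zero_at (P : CuspidalAutomorphicRepGL n K μ)
    (S : Finset (HeightOneSpectrum (𝓞 K))) (α : SatakeFamily K) (hα : IsSatakeFamilyOf P ↑S α)
    [MeasurableSpace (GL (Fin n) (AdeleRing (𝓞 K) K))] [BorelSpace (GL (Fin n) (AdeleRing (𝓞 K) K))]
    (ν : Measure (GL (Fin n) (AdeleRing (𝓞 K) K))) [ν.IsHaarMeasure] (s₀ : ℂ) :
    ∃ Φ ∈ schwartzBruhatAdelicMatrix n K, ∃ φ ∈ P.1, IsKFiniteVector μ φ ∧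
      ∃ A : ℂ → ℂ, Differentiable ℂ A ∧ A s₀ ≠ 0 ∧
        ∀ s : ℂ, (n : ℝ) * n + n + 3 < s.re →
          gjZeta μ ν Φ φ φ (s + ((n : ℂ) - 1) / 2) = A s * partialStandardL ↑S α s := by
  haveI : LocallyCompactSpace (GL (Fin n) (AdeleRing (𝓞 K) K)) := AdelicGroupData.locallyCompactSpace_gl_adelic_holds n K
  haveI : SecondCountableTopology (GL (Fin n) (AdeleRing (𝓞 K) K)) :=
    secondCountableTopology_generalLinearGroup_adeleRing K (Fin n)
  -- Step 1: a non-zero `K`-finite vector of an `S`-good level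
  obtain ⟨𝔫₀, φ, h𝔫₀, h𝔫₀S, hφP, hφ0, hφfix, hφK⟩ := exists_isKFiniteVector_sGoodLevel P
    (↑S : Set (HeightOneSpectrum (𝓞 K))) fun w hw => hα.isUnramifiedAt hw
  -- Step 2: the unfolding data at the level of `φ`, adapted to the line `im s = im s₀`
  obtain ⟨𝔫, h𝔫, Φinf, N, hST, hT₀, hTS, -, hΦ01, hΦ1, hN, hsupp⟩ :=
    exists_unfolding_data_of_level (μ := μ) S hφ0 h𝔫₀ hφfix s₀.im
  set T : Finset (HeightOneSpectrum (𝓞 K)) := primesOf h𝔫 with hTdef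
  have hTS' : T ⊆ S := fun w hw => by
    rcases hTS w hw with h | h
    · exact h
    · exact Finset.mem_coe.1 (h𝔫₀S w h)
  have hφT : ∀ k ∈ awayLevel K n T, (AdelicGroupData.gl n K).rightRegular μ k φ = φ := fun k hk =>
    hφfix k (awayLevel_le_principalCongruenceLevel h𝔫₀ hT₀ hk)
  have hαT : IsSatakeFamilyOf P (↑T : Set (HeightOneSpectrum (𝓞 K))) α := fun v hv =>
    hα v fun h => hv (Finset.mem_coe.2 (hST (Finset.mem_coe.1 h)))
  have hcard : ∀ v : HeightOneSpectrum (𝓞 K), v ∉ S → Multiset.card (α v) = n := by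
    intro v hv
    obtain ⟨𝔪, -, -, ϖ, hsat⟩ := hα v (fun h => hv (Finset.mem_coe.1 h))
    exact hsat.card_eq
  -- Step 3: the test function and its `G_T`-part
  set Φ := gjTestFunction n K Φinf 𝔫 with hΦdef
  set Ψ : GL (Fin n) (AdeleRing (𝓞 K) K) → ℂ := gjTestFunctionG n K Φinf 𝔫 with hΨdef
  have hΨc : Continuous Ψ := continuous_gjTestFunctionG Φinf h𝔫
  have hΨN : ∀ a : placesFactor K n T, Ψ a ≠ 0 → (a : GL (Fin n) (AdeleRing (𝓞 K) K)) ∈ N :=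
    fun a ha => (hsupp a ha).1
  -- Step 4: Haar measures on the factors and comparison with `ν`
  letI : MeasurableSpace (awayFactor K n T) := borel _
  haveI : BorelSpace (awayFactor K n T) := ⟨rfl⟩
  letI : MeasurableSpace (placesFactor K n T) := borel _
  haveI : BorelSpace (placesFactor K n T) := ⟨rfl⟩
  haveI := locallyCompactSpace_awayFactor K n T
  haveI := locallyCompactSpace_placesFactor K n T
  set μH : Measure (awayFactor K n T) := Measure.haar with hμH
  set μG : Measure (placesFactor K n T) := Measure.haar with hμG
  set m := awayProductMeasure K n T μH μG with hm
  haveI : m.IsHaarMeasure := isHaarMeasure_awayProductMeasure μH μG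
  set c : ℝ≥0 := ν.haarScalarFactor m with hc
  have hν : ν = c • m := Measure.isMulLeftInvariant_eq_smul ν m
  have hc0 : 0 < c := Measure.haarScalarFactor_pos_of_isHaarMeasure ν m
  have hvol0 : 0 < (μH (awayLevelIn K n T)).toReal :=
    ENNReal.toReal_pos ((isOpen_awayLevelIn K n T).measure_pos μH ⟨1, one_mem _⟩).ne'
      (measure_awayLevelIn_lt_top μH).ne
  -- Step 5: the local Euler polynomials and the function `A`
  set Pv : HeightOneSpectrum (𝓞 K) → ℂ → ℂ := fun v s => (eulerPolynomial (α v)).eval ((v.residueCard : ℂ) ^ (-s)) with hPv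
  set C : ℂ := ((c : ℝ) : ℂ) * ((μH (awayLevelIn K n T)).toReal : ℂ) with hC
  have hC0 : C ≠ 0 := mul_ne_zero (Complex.ofReal_ne_zero.2 (NNReal.coe_pos.2 hc0).ne')
    (Complex.ofReal_ne_zero.2 hvol0.ne')
  set A : ℂ → ℂ := fun s => C * placesZeta T μG Ψ φ (s + ((n : ℂ) - 1) / 2) with hA
  have hAd : Differentiable ℂ A := by
    refine (differentiable_const C).mul ?_
    exact (differentiable_placesZeta μG hΨc hN hΨN φ).comp (differentiable_id.add (differentiable_const _))
  -- Step 6: non-vanishing at `s₀`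
  have hA0 : A s₀ ≠ 0 := by
    refine mul_ne_zero hC0 fun h0 => ?_
    have hpos := re_placesZeta_pos_of_im_eq μG hΨc (exists_gjTestFunctionG_eq hΦ01 𝔫) (gjTestFunctionG_one hΦ1 𝔫)
      hN hφ0 hsupp (s := s₀ + ((n : ℂ) - 1) / 2) (im_add_half_sub_one s₀)
    rw [h0, Complex.zero_re] at hpos
    exact lt_irrefl _ hpos
  -- Step 7: the witnesses
  refine ⟨Φ, gjTestFunction_mem Φinf h𝔫, φ, hφP, hφK, A, hAd, hA0, fun s hs => ?_⟩
  -- Step 8: the identity on the half-plane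
  set s' : ℂ := s + ((n : ℂ) - 1) / 2 with hs'def
  have hs' : (n : ℝ) * n + n + 2 ≤ s'.re := by
    rw [hs'def, re_add_half_sub_one]
    nlinarith [(Nat.cast_nonneg n : (0 : ℝ) ≤ n)]
  have hsre : (n : ℝ) ^ 2 + 2 ≤ s.re := by nlinarith [(Nat.cast_nonneg n : (0 : ℝ) ≤ n)]
  -- unfolding for `dh ⊗ da`
  have hmain := gjZeta_awayProductMeasure_eq μH μG P hαT hφP hφ0 hφT φ hs' Φ
    (fun a : placesFactor K n T => Ψ (a : GL (Fin n) (AdeleRing (𝓞 K) K)))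
    (fun h a => gjTestFunction_mul Φinf h𝔫 h a) (continuous_gjTestFunction Φinf h𝔫)
    (integrable_norm_mul_adelicAbsDet_rpow μG hΨc hN hΨN s'.re)
  -- the Euler product over the places outside `T` at `s'` is `L^T(s)`
  have hbridge : ∀ i : {w : HeightOneSpectrum (𝓞 K) // w ∉ T}, localEulerInv n (α i.1) i.1 s' = (Pv i.1 s)⁻¹ :=
    fun i => localEulerInv_eq_inv_eval (hcard i.1 fun h => i.2 (hST h)) i.1 s
  have hmult : Multipliable fun i : {w : HeightOneSpectrum (𝓞 K) // w ∉ T} => (Pv i.1 s)⁻¹ :=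
    ((hasSum_unfoldTerm_intCosetsAway P hαT hφP hφ0 hφT φ hs').1).congr hbridge
  have hsplit := partialStandardL_eq_prod_mul_tprod hST α s hmult
  have htprod : (∏' i : {w : HeightOneSpectrum (𝓞 K) // w ∉ T}, localEulerInv n (α i.1) i.1 s') =
      ∏' i : {w : HeightOneSpectrum (𝓞 K) // w ∉ T}, (Pv i.1 s)⁻¹ := tprod_congr hbridge
  -- no finite Euler polynomial: `T ∖ S = ∅`
  have hempty : T \ S = ∅ := Finset.sdiff_eq_empty_iff_subset.2 hTS'
  rw [hempty, Finset.prod_empty, one_mul] at hsplit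
  -- assemble
  rw [hν, gjZeta_smul_measure, hmain.2, htprod, hsplit]
  have hAs : A s = ((c : ℝ) : ℂ) * ((μH (awayLevelIn K n T)).toReal : ℂ) * placesZeta T μG Ψ φ s' := by
    simp only [hA, hC, hs'def, mul_assoc]
  rw [hAs]
  simp only [placesZeta]
  ring

/-- **Godement–Jacquet, Thm. 13.8 (entire case), for honest partial standard L-functions in
`L²_cusp`.** For a cuspidal automorphic representation `Π ⊂ L²_cusp(GL_n(K) A_G \ GL_n(𝔸_K))` with
`n ≥ 2`, a finite set `S` of finite places and an honest Satake family `α` of `Π` off `S`, the partial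
standard L-function `L^S(s, Π) = ∏_{v ∉ S} ∏_{a ∈ α v} (1 - a q_v^{-s})⁻¹` has entire continuation:
for every `s₀`, `Z(Φ, s + (n-1)/2, φ, φ) = A(s) L^S(s, Π)` far to the right with `A` entire,
`A(s₀) ≠ 0` (`exists_gjZeta_eq_mul_partialStandardL_ne_zero_at`) and `Z` entire for `n ≥ 2`
(`GodementJacquet1972_gjZeta_meromorphic_holds`); `L^S` is holomorphic on `re s > 1`
(Jacquet–Shalika, `differentiableOn_partialStandardL_of_summable`); conclude by
`hasEntireContinuation_of_quotients`. [cite: GodementJacquet1972, Thm. 13.8]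
[cite: JacquetShalikaAJM1981, Thm. (5.3)] -/
theorem hasEntireContinuation_partialStandardL_of_two_le (P : CuspidalAutomorphicRepGL n K μ)
    (hn : 2 ≤ n) (S : Finset (HeightOneSpectrum (𝓞 K))) (α : SatakeFamily K)
    (hα : IsSatakeFamilyOf P ↑S α) :
    Literature.NumberTheory.GaloisRepresentations.LFunction.HasEntireContinuation (partialStandardL ↑S α) := by
  refine hasEntireContinuation_of_quotients
    (differentiableOn_partialStandardL_of_summable summable_normSq_trace_satakePow_holds P hα) fun s₀ => ?_
  letI : MeasurableSpace (GL (Fin n) (AdeleRing (𝓞 K) K)) := borel _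
  haveI : BorelSpace (GL (Fin n) (AdeleRing (𝓞 K) K)) := ⟨rfl⟩
  haveI : LocallyCompactSpace (GL (Fin n) (AdeleRing (𝓞 K) K)) :=
    AdelicGroupData.locallyCompactSpace_gl_adelic_holds n K
  obtain ⟨Φ, hΦ, φ, hφ, hKφ, A, hA, hA0, hZA⟩ :=
    exists_gjZeta_eq_mul_partialStandardL_ne_zero_at P S α hα
      (Measure.haar : Measure (GL (Fin n) (AdeleRing (𝓞 K) K))) s₀
  obtain ⟨x₁, -, g, -, hge, hgZ⟩ := GodementJacquet1972_gjZeta_meromorphic_holds P Φ hΦ φ φ hφ hφ hKφ hKφ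
    (Measure.haar : Measure (GL (Fin n) (AdeleRing (𝓞 K) K)))
  refine ⟨max ((n : ℝ) * n + n + 3) (x₁ - ((n : ℝ) - 1) / 2), fun s => g (s + ((n : ℂ) - 1) / 2), A,
    (hge hn).comp (differentiable_id.add (differentiable_const _)), hA, hA0, fun s hs => ?_⟩
  have hs₀ : (n : ℝ) * n + n + 3 < s.re := lt_of_le_of_lt (le_max_left _ _) hs
  have hs₁ : x₁ < (s + ((n : ℂ) - 1) / 2).re := by
    have := lt_of_le_of_lt (le_max_right _ _) hs
    rw [re_add_half_sub_one]
    linarith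
  dsimp only
  rw [hgZ _ hs₁, hZA s hs₀]

end Summit.Langlands.Langlands.Theorems.DedekindQuotient1951

end
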